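import Literature.AlgebraicGeometry.Resolution.HenselizedFunctionFieldsImmediate
import Mathlib.FieldTheory.PurelyInseparable.Basic
import Mathlib.FieldTheory.Galois.Basic
import HarnessLib

/-!
# Normal extensions of degree `p` of henselized inertially generated function fields: the two cases (Kuhlmann 2010, §5, p. 20; Cor. 4.2, Prop. 3.1)

Topic: `Literature/AlgebraicGeometry/Resolution` (valued function fields). First layer of the
decomposition of the named fact `Kuhlmann2010NormalDegreePDefectless`
(`HenselizedFunctionFields.lean`) = the step "By Corollary 4.2 or Proposition 3.1, this
extension is defectless" on p. 20 of F.-V. Kuhlmann, *Elimination of ramification I: The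
generalized stability theorem*, Trans. AMS 362 (2010) 5697–5727 = arXiv:1003.5678, for a
normal extension `N'|N` of degree `p` of a henselized inertially generated function field `N`
of rank one with a residue-transcendental generator over an algebraically closed `K`
(`IsHenselizedInertiallyGeneratedRT`), along the printed case distinction of p. 19:

> Consequently, `E.F^r|F^r` is a finite tower of normal extensions of degree `p`, either
> Galois or purely inseparable. … [p. 20] there is a normal subextension `E'|N` of `E.N|N` of
> degree `p`. By Corollary 4.2 or Proposition 3.1, this extension is defectless.

A normal extension of prime degree `p` is either separable — hence Galois — or, its maximal
separable subextension being trivial, purely inseparable; the Galois steps are Cor. 4.2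
("every Galois extension `(E|F,v)` of degree `p` is defectless"), the purely inseparable steps
are Prop. 3.1 (the "inseparably defectless" version of Thm. 1.1) transported to the
henselization by Thm. 2.14 and Lemma 2.3.

## Content

* `IsGaloisStep p M T`, `IsPurelyInseparableStep p M T` — "Galois extension of degree `p`"
  (Cor. 4.2), "purely inseparable [normal extension of degree `p`]" (p. 19) inside the ambient
  `Ω`, companions of `IsNormalStep` (`HenselizedFunctionFields.lean`). DEFINITIONS, with
  `IsGaloisStep.isNormalStep`, `IsPurelyInseparableStep.isNormalStep` and
  `IsNormalStep.isGaloisStep_or_isPurelyInseparableStep` (prime degree). PROVED.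
* NAMED FACTS, each in the form in which p. 20 consumes it (same ambient rendering and same
  specialisation — `K` algebraically closed, residue-transcendental generator, rank one — as
  `Kuhlmann2010NormalDegreePDefectless`):
  `Kuhlmann2010GaloisDegreePDefectless` (Cor. 4.2), `Kuhlmann2010PurelyInseparableDegreePDefectless`
  (Prop. 3.1 with Thm. 2.14 and Lemma 2.3).
* `Kuhlmann2010NormalDegreePDefectless.of_cases` — the named fact of
  `HenselizedFunctionFields.lean` from the two cases. PROVED.

## Sources

* F.-V. Kuhlmann, *Elimination of ramification I: The generalized stability theorem*, Trans.
  Amer. Math. Soc. 362 (2010) 5697–5727 = arXiv:1003.5678: §2.1 Lemma 2.3, §2.3 Thm. 2.14,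
  §2.5 (henselized inertially generated function fields, (2.7)), §3 Prop. 3.1, §4 ((4.1),
  (4.3), Prop. 4.1, Cor. 4.2, Props. 4.12–4.13), §5 proof of (R4), pp. 19–20.

## Rendering notes

* As in `HenselizedFunctionFields.lean`: one algebraically closed valued field `(Ω, V)` with
  `char Ωv = p > 0`, fields = `Subfield Ω` valued by restriction of `V`, `K ≤ Ω` a subfield
  which is an algebraically closed field, "`E'|N` of degree `p`" = `N ≤ N'` with
  `[N' : N] = p` for the intermediate field `Subfield.extendScalars`, "defectless" =
  `IsDefectlessExtension V N N'` (`[N' : N] = (vN' : vN)·[N'v : Nv]` for the extension `V ∩ N'`,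
  the unique one over the henselian `N`, `IsHenselizedInertiallyGeneratedRT.isHenselianField`).
* Cor. 4.2 is printed for "`(F|K,v)` a henselized inertially generated function field of
  transcendence degree 1 and rank 1" with "`(K,v)` a defectless field", under the standing
  hypothesis (4.1) of §4 ("`(K,v)` is henselian and `p = char K̄ > 0`, and `K` is closed under
  `p`-th roots") and for `F` of the form (4.2) or (4.3); an algebraically closed `K ≤ Ω` with
  the restriction of `V` is henselian, closed under `p`-th roots and defectless (it has no
  proper finite extension), and a field of the class `IsHenselizedInertiallyGeneratedRT V K` is
  of the form (4.3) by §2.5, (2.7) ("`(F|K,v)` is henselized inertially generated with generator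
  `x` if and only if there exists some `y ∈ F` such that `F = K(x)^h(y)`, `vy = 0` and
  `K(x)‾(ȳ)|K(x)‾` is a finite separable extension of degree `[K(x,y):K(x)] = [K(x)^h(y):K(x)^h]`")
  and the paragraph before Lemma 2.26 ("`vF = vK` is divisible and `K̄` algebraically closed in
  the residue-transcendental case"). The fact is vendored in this specialisation, which is the
  one p. 20 uses; nothing is claimed for fields the source does not cover.
* Prop. 3.1 is printed for valued function fields `(F|K,v)` without transcendence defect over an
  inseparably defectless `(K,v)`; p. 20 applies it to the henselized field `N = K(x)^h(y) =
  K(x,y)^h` (Lemma 2.3: "If `L|K` is algebraic, then `(L.K^h,v)` is the henselization of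
  `(L,v)`") through Thm. 2.14 ("The same holds for … 'inseparably defectless' in the place of
  'defectless'"): `K(x,y)|K` has transcendence degree `1 = 0 + trdeg(K̄(x̄,ȳ)|K̄)`, no
  transcendence defect, and `K` algebraically closed is inseparably defectless.
-/

noncomputable section

open IsLocalRing

namespace Literature.AlgebraicGeometry.Resolution

universe u

variable {Ω : Type u} [Field Ω] (V : ValuationSubring Ω)

/-! ### Galois steps and purely inseparable steps of degree `p` -/

section Steps

/-- **Galois extension of degree `p`** inside `Ω` (Kuhlmann 2010, Cor. 4.2: "every Galois
extension `(E|F,v)` of degree `p`"; p. 19: "a finite tower of Galois extensions of degree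
`p`"): `M ≤ T` with `[T : M] = p` and `T|M` Galois, for the intermediate field structure
`Subfield.extendScalars`. Companion of `IsNormalStep`. [cite: Kuhlmann2010, Cor. 4.2 and Section 5, proof of (R4) (p. 19)] -/
def IsGaloisStep (p : ℕ) (M T : Subfield Ω) : Prop :=
  ∃ h : M ≤ T, Module.finrank M (Subfield.extendScalars h) = p ∧ IsGalois M (Subfield.extendScalars h)

/-- **Purely inseparable extension of degree `p`** inside `Ω` (Kuhlmann 2010, p. 19: "a finite
tower of normal extensions of degree `p`, either Galois or purely inseparable"): `M ≤ T` with
`[T : M] = p` and `T|M` purely inseparable. Companion of `IsNormalStep`.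
[cite: Kuhlmann2010, Section 5, proof of (R4) (p. 19)] -/
def IsPurelyInseparableStep (p : ℕ) (M T : Subfield Ω) : Prop :=
  ∃ h : M ≤ T, Module.finrank M (Subfield.extendScalars h) = p ∧
    IsPurelyInseparable M (Subfield.extendScalars h)

/-- A Galois step is a normal step (Galois ⇒ normal). [folklore] -/
theorem IsGaloisStep.isNormalStep {p : ℕ} {M T : Subfield Ω} (h : IsGaloisStep p M T) :
    IsNormalStep p M T := by
  obtain ⟨hle, hdeg, hgal⟩ := h
  exact ⟨hle, hdeg, hgal.to_normal⟩

/-- `M ≤ T` along a Galois step. [folklore] -/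
theorem IsGaloisStep.le {p : ℕ} {M T : Subfield Ω} (h : IsGaloisStep p M T) : M ≤ T :=
  h.1

/-- A purely inseparable step is a normal step (purely inseparable ⇒ normal,
`IsPurelyInseparable.normal`). [folklore] -/
theorem IsPurelyInseparableStep.isNormalStep {p : ℕ} {M T : Subfield Ω}
    (h : IsPurelyInseparableStep p M T) : IsNormalStep p M T := by
  obtain ⟨hle, hdeg, hpi⟩ := h
  haveI := hpi
  exact ⟨hle, hdeg, inferInstance⟩

/-- `M ≤ T` along a purely inseparable step. [folklore] -/
theorem IsPurelyInseparableStep.le {p : ℕ} {M T : Subfield Ω} (h : IsPurelyInseparableStep p M T) :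
    M ≤ T :=
  h.1

/-- **A normal extension of prime degree `p` is either Galois or purely inseparable** (Kuhlmann
2010, p. 19: "normal extensions of degree `p`, either Galois or purely inseparable"): the
maximal separable subextension `S` of `T|M` has degree dividing `p`; if `[S : M] = p` then
`S = T` is separable and normal, i.e. Galois; if `[S : M] = 1` then `S = M` and `T|M` is purely
inseparable (`separableClosure.eq_bot_iff`). PROVED. [cite: Kuhlmann2010, Section 5, proof of (R4) (p. 19)] -/
theorem IsNormalStep.isGaloisStep_or_isPurelyInseparableStep {p : ℕ} (hp : p.Prime)
    {M T : Subfield Ω} (h : IsNormalStep p M T) :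
    IsGaloisStep p M T ∨ IsPurelyInseparableStep p M T := by
  obtain ⟨hle, hdeg, hnorm⟩ := h
  haveI : FiniteDimensional M (Subfield.extendScalars hle) :=
    Module.finite_of_finrank_pos (by rw [hdeg]; exact hp.pos)
  haveI : Algebra.IsAlgebraic M (Subfield.extendScalars hle) :=
    Algebra.IsAlgebraic.of_finite M _
  -- the maximal separable subextension has degree dividing `p`
  have hdvd : Module.finrank M (separableClosure M (Subfield.extendScalars hle)) ∣ p := by
    rw [← hdeg, ← IntermediateField.finrank_top' (F := M) (E := Subfield.extendScalars hle)]
    exact IntermediateField.finrank_dvd_of_le_right le_top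
  rcases (Nat.dvd_prime hp).mp hdvd with h1 | hp'
  · -- degree `1`: the separable closure is `M`, the extension is purely inseparable
    right
    have hS : separableClosure M (Subfield.extendScalars hle) = ⊥ :=
      IntermediateField.finrank_eq_one_iff.mp h1
    exact ⟨hle, hdeg, separableClosure.eq_bot_iff.mp hS⟩
  · -- degree `p`: the extension is separable, hence Galois
    left
    have hS : separableClosure M (Subfield.extendScalars hle) = ⊤ :=
      IntermediateField.eq_of_le_of_finrank_eq le_top
        (by rw [hp', IntermediateField.finrank_top', hdeg])
    haveI : Algebra.IsSeparable M (Subfield.extendScalars hle) :=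
      (separableClosure.eq_top_iff M (Subfield.extendScalars hle)).mp hS
    exact ⟨hle, hdeg, isGalois_iff.mpr ⟨inferInstance, hnorm⟩⟩

end Steps

/-! ### The two cases as named facts -/

/-- NAMED FACT — **Kuhlmann 2010, Cor. 4.2 (Galois extensions of degree `p` are defectless), in
the form used on p. 20.** Cor. 4.2: "Let `(F|K,v)` be a henselized inertially generated function
field of transcendence degree 1 and rank 1. If `(K,v)` is a defectless field, then every Galois
extension `(E|F,v)` of degree `p` is defectless" — under the standing hypothesis (4.1) of §4
("`(K,v)` is henselian and `p = char K̄ > 0`, and `K` is closed under `p`-th roots") and for `F`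
of the form (4.2) or (4.3); it follows from Prop. 4.1 ("either `(E|F,v)` is defectless or there
is a Galois extension `L|K` of degree `p` with non-trivial defect such that `(L.E|L.F,v)` is
defectless"), proved in the residue-transcendental case by the normal forms of Prop. 4.12
(`char K = p`, Artin–Schreier generators over a lifted Frobenius-closed basis, Lemma 4.10) and
Prop. 4.13 (`char K = 0`, Kummer generators, Lemma 4.11, Cor. 2.11). Rendering (the case p. 20
uses: "By Corollary 4.2 …, this extension is defectless"): `(Ω, V)` algebraically closed with
`char Ωv = p > 0`, `K ≤ Ω` a subfield which is an algebraically closed field — hence henselian,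
closed under `p`-th roots and defectless, with no Galois extension of degree `p` at all —, `N`
in the class `IsHenselizedInertiallyGeneratedRT V K` (of the form (4.3) by §2.5, (2.7)),
`N ≤ N'` Galois of degree `p` (`IsGaloisStep`); then `(N'|N, v)` is defectless
(`IsDefectlessExtension`: `p = [N' : N] = (vN' : vN)·[N'v : Nv]`). Its proof is §4 of the source
(with [K5], Thm. 10, Hensel's Lemma and Lemma 2.4), not in Mathlib. Users take
`(h : Kuhlmann2010GaloisDegreePDefectless)`.
[cite: Kuhlmann2010, Cor. 4.2 (with Prop. 4.1, Props. 4.12–4.13, Section 5 p. 20)] -/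
def Kuhlmann2010GaloisDegreePDefectless : Prop :=
  ∀ (Ω : Type u) [Field Ω] [IsAlgClosed Ω] (V : ValuationSubring Ω) (p : ℕ) [CharP (ResidueField V) p],
    p.Prime → ∀ (K N N' : Subfield Ω), IsAlgClosed K → IsHenselizedInertiallyGeneratedRT V K N →
    IsGaloisStep p N N' → IsDefectlessExtension V N N'

/-- NAMED FACT — **Kuhlmann 2010, Prop. 3.1 with Thm. 2.14 and Lemma 2.3 (purely inseparable
extensions of degree `p` are defectless), in the form used on p. 20.** Prop. 3.1: "Let `(F|K,v)`
be a valued function field without transcendence defect. If `(K,v)` is an inseparably defectless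
field, then so is `(F,v)`"; Thm. 2.14: "`(K,v)` is defectless if and only if its henselization
`(K,v)^h` in `(K̃,v)` is defectless. The same holds for 'separably defectless' and 'inseparably
defectless'"; Lemma 2.3: "If `L|K` is algebraic, then `(L.K^h,v)` is the henselization of
`(L,v)`". On p. 20 ("By … Proposition 3.1, this extension is defectless") they are applied to a
purely inseparable normal step `E'|N` of degree `p`: `N = K(x)^h(y) = K(x,y)^h` is the
henselization of the function field `K(x,y)|K` of transcendence degree `1` without transcendence
defect (`x̄` transcendental over `K̄`) over the algebraically closed, hence inseparably
defectless, `K`; so `N` is inseparably defectless, i.e. defectless in `E'` for the unique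
extension `V ∩ E'` of the valuation of the henselian `N`. Rendering: `(Ω, V)` algebraically
closed with `char Ωv = p > 0`, `K ≤ Ω` an algebraically closed subfield, `N` in
`IsHenselizedInertiallyGeneratedRT V K`, `N ≤ N'` purely inseparable of degree `p`
(`IsPurelyInseparableStep`); then `IsDefectlessExtension V N N'`. Users take
`(h : Kuhlmann2010PurelyInseparableDegreePDefectless)`.
[cite: Kuhlmann2010, Prop. 3.1, Thm. 2.14 and Lemma 2.3 (with Section 5 p. 20)] -/
def Kuhlmann2010PurelyInseparableDegreePDefectless : Prop :=
  ∀ (Ω : Type u) [Field Ω] [IsAlgClosed Ω] (V : ValuationSubring Ω) (p : ℕ) [CharP (ResidueField V) p],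
    p.Prime → ∀ (K N N' : Subfield Ω), IsAlgClosed K → IsHenselizedInertiallyGeneratedRT V K N →
    IsPurelyInseparableStep p N N' → IsDefectlessExtension V N N'

/-! ### Assembly of the first layer -/

/-- **Kuhlmann 2010, p. 20, "By Corollary 4.2 or Proposition 3.1, this extension is defectless"**:
the named fact `Kuhlmann2010NormalDegreePDefectless` from its two cases — a normal step of prime
degree `p` is a Galois step (Cor. 4.2, `Kuhlmann2010GaloisDegreePDefectless`) or a purely
inseparable step (Prop. 3.1 with Thm. 2.14 and Lemma 2.3,
`Kuhlmann2010PurelyInseparableDegreePDefectless`). PROVED.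
[cite: Kuhlmann2010, Section 5, proof of (R4) (pp. 19–20)] -/
theorem Kuhlmann2010NormalDegreePDefectless.of_cases
    (hG : Kuhlmann2010GaloisDegreePDefectless.{u})
    (hI : Kuhlmann2010PurelyInseparableDegreePDefectless.{u}) :
    Kuhlmann2010NormalDegreePDefectless.{u} := by
  intro Ω _ _ V p _ hp K N N' hK hN hstep
  rcases hstep.isGaloisStep_or_isPurelyInseparableStep hp with hg | hi
  · exact hG Ω V p hp K N N' hK hN hg
  · exact hI Ω V p hp K N N' hK hN hi

end Literature.AlgebraicGeometry.Resolution
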